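import Summits.QuantumAdvantage.QuantumAdvantage.Theorems.SteerDialItems
import Summits.QuantumAdvantage.QuantumAdvantage.Theorems.SpreadBridge
import Summits.QuantumAdvantage.QuantumAdvantage.Theorems.SteerDialWindow
import Summits.QuantumAdvantage.AdviceFreeQNC0.AffBells23RingCondProofs
import Summits.QuantumAdvantage.QuantumAdvantage.Theorems.SpreadDialNandRing
import Summits.QuantumAdvantage.QuantumAdvantage.Theorems.SpreadDialNoShadowLemmas
import HarnessLib

/-!
# CylinderDial, part 4/4: the `δ₀`-ring hosts ANY parity of answer functions; the rough family `Q★` = NAND of parities of `MOD₃`-tests (support for items stmt-QuantumAdvantage-30910, stmt-QuantumAdvantage-28375)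

Land port of §7 of the node «CylinderDial» (cell decomp-qadv, lens-5, g13).  `exists_parity_ring`: on the ring of length `8t`
with pattern `δ₀`, placing arbitrary answer functions `b_s` (`s < M ≤ 4t`, degree `≤ D`) at the odd positions `2s+1` gives a
strategy of degree `≤ D` whose win event is `{y : #{s : b_s(y) = 1} even}` (tree `Theorems.rel_delta0_iff`).  `exists_mod3Nand_ring`:
hence ONE ring of degree `≤ 2r` realises `NAND(ℓ′_1,…,ℓ′_r)`, `ℓ′_j(y) = #{b < m_j : Σ_i C_{j,b,i}[y_i] ≡ 0 (mod 3)} mod 2`, for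
arbitrary coefficient data `C` with `∏ m_j ≤ 4t` — generalising `TameDial.exists_nand_ring` (monomial bits) to `MOD₃`-test bits.
This is the located core of the residual `JBridge3` (part 1) and of the `m = 1` case of CodimDial's `FewCover3` (28375).
No `sorry`, no new axioms, no instances, no notation.
-/

set_option linter.style.longLine false
set_option linter.dupNamespace false

noncomputable section
open scoped Classical

namespace Summit.QuantumAdvantage.QuantumAdvantage.Theorems.CylinderDial

open Finset
open Literature.Computability.QuantumComplexity Literature.Computability.QuantumComplexity.RingHLF
open Literature.Computability.MetaComplexity
open Summit.QuantumAdvantage.AdviceFreeQNC0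
open Summit.QuantumAdvantage.QuantumAdvantage.Theses

/-! ## §7  The next rough family — the LOCATED CORE of the residual `JBridge3` (hosting PROVED)

`exists_parity_ring`: the tree's `δ₀`-ring of length `8t` HOSTS THE PARITY OF ANY `M ≤ 4t` ANSWER FUNCTIONS (put `b_s` at
the odd position `2s+1`; `Theorems.rel_delta0_iff`).  `exists_mod3Nand_ring`: hence ONE ring of degree `2r` realises the
win event `NAND(ℓ′₁,…,ℓ′_r)`, `ℓ′_j(y) = ⊕_{b < m_j} [Σ_i C_{j,b,i}·[y_i] ≡ 0 (mod 3)]` — parities of `MOD₃`-TESTS instead of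
g8's parities of coordinates (`TameDial.exists_nand_ring` is the case of monomial bits).  With full-support coefficient
vectors `C_{j,b} ∈ {1,2}^{8t}`, `m_j = n^{1/r}`, `r ≈ log₂(1/η)+1` this system `Q★` is
* DENSE (heuristic/INSTRUMENTABLE, I-QSTAR-v1: the `r` parities are nearly unbiased and independent, deviation `≈ 2^{-r} ≤ η`);
* NOT junta-answered (every answer bit has support `8t`): it lies in `JBridge3`'s regime, not in `JCover3`'s;
* conjecturally NOWHERE CYLINDER-TAME: freezing `≤ n/2` coordinates leaves generic affine `MOD₃`-tests on `≥ n/2` free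
  coordinates, and `NAND` of parities of `n^{1/r}` such tests has (conjecturally, Smolensky-type: approximate `𝔽₃`-degree
  of a parity of `m` near-independent bits is `Θ(√(m·log(1/ε)))`) no `(log₂ n)^{c'}`-degree inner core with leak `n^{-i}` —
  so `Q★` is the CANDIDATE REFUTER of the general law `CylTame3` (whence the node's law is the junta-restricted `CylTameJ3`);
* ONE ring (`m = 1`): it sits on the ATTACKED side `FewCover3` (28375) of the sibling route CodimDial, and on the residual
  side `JBridge3` of this node — the two exact splits (few/many rings; junta/general answers) are ORTHOGONAL axes;
* beyond every SOUND restriction method: the generalised "cylinders" that WOULD tame it — fibres `{y : u_b(y) = ε_b ∀ b}` of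
  poly-many low-degree bits, or `𝔽₂`-affine fibres `{y : ⊕_{i∈W} y_i = a_W}` — are UNSOUND on the victim side: window-
  parity advice (`W` = consecutive windows of length `(log₂ n)²`, allowed-pattern sets `A_W` of even weight, `|∩| ≥ 2^{n/2}`)
  makes the `S₃`-monodromy prefix products of the victim's ring `(log₂ n)^{O(1)}`-degree computable over `𝔽₃`
  (signs constant on the fibre, the `ℤ₃`-part a signed `MOD₃`-sum of window juntas), so a low-degree strategy is PERFECT on
  such a fibre and relative loss there is `0` (ADVICE VARIETIES; prose, not formalised here).  Coordinate cylinders do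
  not leak this advice (the parity of the `≥ n/2` free coordinates stays hidden; `p = 2` sibling PROVED for every frozen
  word: `AffBells22.walkHardAllSubcube`). -/

section RoughFamily

variable {n : ℕ}

/-- products of low-degree functions (degree bookkeeping). -/
theorem prod_mem_lowDeg {ι : Type*} (s : Finset ι) (f : ι → Smolensky.CubeFn (ZMod 3) n) {D : ℕ}
    (hf : ∀ i ∈ s, f i ∈ Smolensky.lowDeg (ZMod 3) n D) :
    ∏ i ∈ s, f i ∈ Smolensky.lowDeg (ZMod 3) n (s.card * D) := by
  classical
  induction s using Finset.induction_on with
  | empty => simp only [Finset.prod_empty, Finset.card_empty, zero_mul]; exact Smolensky.one_mem_lowDeg 0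
  | insert a s ha ih =>
    rw [Finset.prod_insert ha, Finset.card_insert_of_notMem ha, Nat.succ_mul, add_comm]
    exact Smolensky.mul_mem_lowDeg_add (hf a (Finset.mem_insert_self _ _))
      (ih fun i hi => hf i (Finset.mem_insert_of_mem hi))

/-- the `MOD₃`-TEST of a coefficient vector `c`: `u_c(y) = 1 - (Σ_i c_i [y_i])²` (`∈ {0,1}`, `= 1 ⟺ Σ_i c_i [y_i] ≡ 0`;
degree 2; support = support of `c`). -/
def mod3Test (c : Fin n → ZMod 3) : Smolensky.CubeFn (ZMod 3) n :=
  fun y => 1 - (∑ i, if y i then c i else 0) ^ 2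

/-- the linear form of `c` as a cube function. -/
def linForm (c : Fin n → ZMod 3) : Smolensky.CubeFn (ZMod 3) n := fun y => ∑ i, if y i then c i else 0

/-- CylinderDialHost helper `linForm_eq_sum` (decomp-qadv land package; see the module docstring). -/
theorem linForm_eq_sum (c : Fin n → ZMod 3) : linForm c = ∑ i, c i • Smolensky.mono (ZMod 3) ({i} : Finset (Fin n)) := by
  ext y
  simp only [linForm, Finset.sum_apply, Pi.smul_apply, smul_eq_mul, Smolensky.mono_apply, Finset.mem_singleton,
    forall_eq, mul_ite, mul_one, mul_zero]

/-- CylinderDialHost helper `linForm_mem_lowDeg` (decomp-qadv land package; see the module docstring). -/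
theorem linForm_mem_lowDeg (c : Fin n → ZMod 3) : linForm c ∈ Smolensky.lowDeg (ZMod 3) n 1 := by
  rw [linForm_eq_sum]
  exact Submodule.sum_mem _ fun i _ => Submodule.smul_mem _ _ (Smolensky.mono_mem_lowDeg (by simp))

/-- CylinderDialHost helper `mod3Test_eq` (decomp-qadv land package; see the module docstring). -/
theorem mod3Test_eq (c : Fin n → ZMod 3) : mod3Test c = 1 - linForm c * linForm c := by
  ext y
  simp only [mod3Test, linForm, Pi.sub_apply, Pi.one_apply, Pi.mul_apply, pow_two]

/-- `MOD₃`-tests have degree `≤ 2`. -/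
theorem mod3Test_mem_lowDeg (c : Fin n → ZMod 3) : mod3Test c ∈ Smolensky.lowDeg (ZMod 3) n 2 := by
  rw [mod3Test_eq]
  have h2 : linForm c * linForm c ∈ Smolensky.lowDeg (ZMod 3) n 2 :=
    Smolensky.lowDeg_mono (by norm_num) (Smolensky.mul_mem_lowDeg_add (linForm_mem_lowDeg c) (linForm_mem_lowDeg c))
  exact Submodule.sub_mem _ (Smolensky.one_mem_lowDeg 2) h2

/-- CylinderDialHost helper `sq_eq_ite_zmod3` (decomp-qadv land package; see the module docstring). -/
theorem sq_eq_ite_zmod3 (a : ZMod 3) : a ^ 2 = if a = 0 then 0 else 1 := by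
  fin_cases a <;> decide

/-- CylinderDialHost helper `mod3Test_apply` (decomp-qadv land package; see the module docstring). -/
theorem mod3Test_apply (c : Fin n → ZMod 3) (y : Fin n → Bool) :
    mod3Test c y = if linForm c y = 0 then 1 else 0 := by
  show 1 - (linForm c y) ^ 2 = _
  rw [sq_eq_ite_zmod3]
  split_ifs <;> decide

/-- `u_c(y) = 1 ⟺ Σ_i c_i [y_i] ≡ 0 (mod 3)`. -/
theorem mod3Test_eq_one_iff (c : Fin n → ZMod 3) (y : Fin n → Bool) : mod3Test c y = 1 ↔ linForm c y = 0 := by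
  rw [mod3Test_apply]
  split_ifs with h
  · exact ⟨fun _ => h, fun _ => rfl⟩
  · exact ⟨fun h01 => absurd h01 (by decide), fun h0 => absurd h0 h⟩

/-- CylinderDialHost helper `mod3Test_zero_or_one` (decomp-qadv land package; see the module docstring). -/
theorem mod3Test_zero_or_one (c : Fin n → ZMod 3) (y : Fin n → Bool) : mod3Test c y = 0 ∨ mod3Test c y = 1 := by
  rw [mod3Test_apply]
  split_ifs
  · exact Or.inr rfl
  · exact Or.inl rfl

/-- ★ HOSTING (PROVED): the `δ₀`-ring of length `8t` hosts the PARITY of any `M ≤ 4t` answer functions `b_s` of degree `≤ D`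
(at degree `≤ D`): the ring relation holds iff an EVEN number of the hosted bits fire. -/
theorem exists_parity_ring {t : ℕ} (ht : 1 ≤ t) {M : ℕ} (hM : M ≤ 4 * t)
    (b : Fin M → Smolensky.CubeFn (ZMod 3) (8 * t)) {D : ℕ} (hb : ∀ s, b s ∈ Smolensky.lowDeg (ZMod 3) (8 * t) D) :
    ∃ Q : Fin (8 * t) → Smolensky.CubeFn (ZMod 3) (8 * t),
      (∀ i, Q i ∈ Smolensky.lowDeg (ZMod 3) (8 * t) D) ∧
      ∀ y, RingHLF.Rel (Theorems.delta0 t) (fun i => decide (Q i y = 1)) ↔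
        (univ.filter fun s => b s y = 1).card % 2 = 0 := by
  classical
  let Q : Fin (8 * t) → Smolensky.CubeFn (ZMod 3) (8 * t) := fun i =>
    if h : i.val % 2 = 1 ∧ i.val / 2 < M then b ⟨i.val / 2, h.2⟩ else 0
  refine ⟨Q, fun i => ?_, fun y => ?_⟩
  · by_cases h : i.val % 2 = 1 ∧ i.val / 2 < M
    · simp only [Q, dif_pos h]; exact hb _
    · simp only [Q, dif_neg h]; exact Submodule.zero_mem _
  · rw [Theorems.rel_delta0_iff ht, Theorems.dot2_oddInd_eq]
    have hbit : ∀ i : Fin (8 * t), decide (Q i y = 1) = true ↔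
        ∃ h : i.val % 2 = 1 ∧ i.val / 2 < M, b ⟨i.val / 2, h.2⟩ y = 1 := by
      intro i
      rw [decide_eq_true_iff]
      by_cases h : i.val % 2 = 1 ∧ i.val / 2 < M
      · simp only [Q, dif_pos h]
        exact ⟨fun h1 => ⟨h, h1⟩, fun ⟨_, h1⟩ => h1⟩
      · simp only [Q, dif_neg h, Pi.zero_apply, zero_ne_one, false_iff]
        rintro ⟨h', _⟩
        exact h h'
    have hcount : ((univ.filter fun i : Fin (8 * t) => i.val % 2 = 1).filter
        fun i => decide (Q i y = 1) = true).card = (univ.filter fun s => b s y = 1).card := by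
      have himg : ((univ.filter fun i : Fin (8 * t) => i.val % 2 = 1).filter fun i => decide (Q i y = 1) = true) =
          (univ.filter fun s : Fin M => b s y = 1).image
            fun s => (⟨2 * s.val + 1, by omega⟩ : Fin (8 * t)) := by
        ext i
        simp only [mem_filter, mem_univ, true_and, mem_image]
        constructor
        · rintro ⟨_, hQ⟩
          obtain ⟨h, h1⟩ := (hbit i).mp hQ
          refine ⟨⟨i.val / 2, h.2⟩, h1, Fin.ext ?_⟩
          dsimp only
          omega
        · rintro ⟨s, hs, rfl⟩
          have h : (2 * s.val + 1) % 2 = 1 ∧ (2 * s.val + 1) / 2 < M := ⟨by omega, by omega⟩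
          refine ⟨h.1, (hbit _).mpr ⟨h, ?_⟩⟩
          have hidx : (⟨(2 * s.val + 1) / 2, h.2⟩ : Fin M) = s := Fin.ext (by dsimp only; omega)
          rw [hidx]
          exact hs
      rw [himg, card_image_of_injective _ (fun a a' hab => Fin.ext (by
        have := congrArg Fin.val hab; dsimp only at this; omega))]
    rw [hcount]

/-- ★ THE ROUGH FAMILY `Q★` (hosting PROVED): for block sizes `m_j` with `∏ m_j ≤ 4t` and ANY coefficient vectors
`C_{j,b} : Fin (8t) → ZMod 3`, ONE single-ring strategy of degree `≤ 2r` on the `δ₀`-ring of length `8t` has win event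
EXACTLY `NAND(ℓ′₁,…,ℓ′_r)`, `ℓ′_j(y) = #{b < m_j : Σ_i C_{j,b,i}[y_i] ≡ 0 (mod 3)} mod 2`. -/
theorem exists_mod3Nand_ring {t : ℕ} (ht : 1 ≤ t) {r : ℕ} (m : Fin r → ℕ) (hM : (∏ j, m j) ≤ 4 * t)
    (C : (j : Fin r) → Fin (m j) → (Fin (8 * t) → ZMod 3)) :
    ∃ Q : Fin (8 * t) → Smolensky.CubeFn (ZMod 3) (8 * t),
      (∀ i, Q i ∈ Smolensky.lowDeg (ZMod 3) (8 * t) (2 * r)) ∧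
      ∀ y, RingHLF.Rel (Theorems.delta0 t) (fun i => decide (Q i y = 1)) ↔
        ¬ ∀ j, (univ.filter fun b : Fin (m j) => linForm (C j b) y = 0).card % 2 = 1 := by
  classical
  set M := Fintype.card ((j : Fin r) → Fin (m j)) with hMdef
  have hMcard : M = ∏ j, m j := by rw [hMdef, Fintype.card_pi]; simp
  have hM4 : M ≤ 4 * t := hMcard ▸ hM
  let e : ((j : Fin r) → Fin (m j)) ≃ Fin M := Fintype.equivFin _
  let bit : Fin M → Smolensky.CubeFn (ZMod 3) (8 * t) := fun s => ∏ j, mod3Test (C j (e.symm s j))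
  have hbit : ∀ s, bit s ∈ Smolensky.lowDeg (ZMod 3) (8 * t) (2 * r) := by
    intro s
    have h := prod_mem_lowDeg (univ : Finset (Fin r)) (fun j => mod3Test (C j (e.symm s j))) (D := 2)
      (fun j _ => mod3Test_mem_lowDeg _)
    rw [Finset.card_univ, Fintype.card_fin] at h
    exact Smolensky.lowDeg_mono (Nat.le_of_eq (Nat.mul_comm r 2)) h
  obtain ⟨Q, hQ, hrel⟩ := exists_parity_ring ht hM4 bit hbit
  refine ⟨Q, hQ, fun y => ?_⟩
  rw [hrel y]
  have hb1 : ∀ s, bit s y = 1 ↔ ∀ j, linForm (C j (e.symm s j)) y = 0 := by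
    intro s
    simp only [bit, Finset.prod_apply]
    constructor
    · intro h j
      by_contra hne
      have h0 : mod3Test (C j (e.symm s j)) y = 0 :=
        (mod3Test_zero_or_one _ _).resolve_right fun h1 => hne ((mod3Test_eq_one_iff _ _).mp h1)
      rw [Finset.prod_eq_zero (Finset.mem_univ j) h0] at h
      exact zero_ne_one h
    · intro h
      exact Finset.prod_eq_one fun j _ => (mod3Test_eq_one_iff _ _).mpr (h j)
  have hcount : (univ.filter fun s => bit s y = 1).card =
      ∏ j, (univ.filter fun b : Fin (m j) => linForm (C j b) y = 0).card := by
    have h1 : (univ.filter fun s => bit s y = 1).card =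
        (univ.filter fun τ : (j : Fin r) → Fin (m j) => ∀ j, linForm (C j (τ j)) y = 0).card := by
      refine card_bij (fun s _ => e.symm s) (fun s hs => ?_) (fun a _ a' _ h => e.symm.injective h)
        (fun τ hτ => ⟨e τ, ?_, e.symm_apply_apply τ⟩)
      · simp only [mem_filter, mem_univ, true_and] at hs ⊢
        exact (hb1 s).mp hs
      · simp only [mem_filter, mem_univ, true_and] at hτ ⊢
        rw [hb1, Equiv.symm_apply_apply]
        exact hτ
    rw [h1]
    have h2 : (univ.filter fun τ : (j : Fin r) → Fin (m j) => ∀ j, linForm (C j (τ j)) y = 0).card =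
        Fintype.card {τ : (j : Fin r) → Fin (m j) // ∀ j, linForm (C j (τ j)) y = 0} :=
      (Fintype.card_subtype _).symm
    rw [h2, Fintype.card_congr (Equiv.subtypePiEquivPi (p := fun j (b : Fin (m j)) => linForm (C j b) y = 0)),
      Fintype.card_pi]
    refine Finset.prod_congr rfl fun j _ => ?_
    exact Fintype.card_subtype _
  rw [hcount]
  have hpar := Theorems.TameDial.prod_mod_two_eq_one_iff (univ : Finset (Fin r))
    (fun j => (univ.filter fun b : Fin (m j) => linForm (C j b) y = 0).card)
  have h01 := Nat.mod_two_eq_zero_or_one (∏ j, (univ.filter fun b : Fin (m j) => linForm (C j b) y = 0).card)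
  constructor
  · intro h0 hall
    have h1 := hpar.mpr fun j _ => hall j
    omega
  · intro hn
    rcases h01 with h0 | h1
    · exact h0
    · exact absurd (fun j => hpar.mp h1 j (mem_univ j)) hn

end RoughFamily


end Summit.QuantumAdvantage.QuantumAdvantage.Theorems.CylinderDial
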